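import Summits.FinalStateConjecture.FinalStateConjecture.Theorems.PhotonSphereChannelsEndVisibleOuterRegion
import HarnessLib

/-!
# Route RenormalisedDrift · crux `DriftCapture` (stmt-FinalStateConjecture-17391), line `registered`,
# stub CENSOR-S `stub_chartsShadowEndVisibleRegion` (= stub S of item stmt-FinalStateConjecture-17673):
# SHADOWING IS A RECURRENCE CONDITION ON THE FAR COMPLETE RAYS

Stub S asks, for every honest decomposition `fd`, that `endVisibleRegion 𝒟 ∩ J⁺(ι X) ⊆ exteriorOf 𝒟 fd.charted`.
The landed route to it is `EndVisible.FarRaysShadowedBy 𝒟 C` ⇒ S at `C`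
(`EndVisible.endVisibleRegion_inter_causalFuture_subset_exteriorOf`), where shadowing says that
outside some compact `K ⊆ X` the chronological past of the nonnegative half of every future-complete
normalised null ray lies in `I⁻(C)` — a statement about the PASTS of whole rays. This file reduces it
to a statement about single ray POINTS at arbitrarily late parameters, the form in which the chart
side of S is argued on paper ("every far-launched complete ray keeps (re-)entering the past of the
radiation zone / of a near zone"):

* §1 `mem_chronologicalPast_of_chronologicalFuture_of_mem_closure` — `q ≪ q'`, `q' ∈ closure I⁻(C)`
  ⇒ `q ∈ I⁻(C)` (the open `I⁺(q)` meets `I⁻(C)`; `I⁻(C)` is a past set); an open set lies in its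
  own chronological past (`subset_chronologicalPast_of_isOpen`), so `closure C ⊆ closure I⁻(C)` for
  open `C`; and the charted late region of a decomposition is open (`isOpen_charted`).
* §2 `farRaysShadowedBy_iff_forall_mem_closure` / `farRaysShadowedBy_iff_raysRecur` — **shadowing by
  `C` is EQUIVALENT to: outside a compact `K`, every point `δ t`, `t ≥ 0`, of every future-complete
  normalised null ray from `p ∉ K` lies in `closure I⁻(C)`; and, by push-up along the ray (the closure
  of a past set is an initial-segment property of the parameter, `EndVisible.mem_closure_of_le_of_isPastSet`),
  to the RECURRENCE form: every such ray has, after every `t ≥ 0`, a parameter `t' ≥ t` with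
  `δ t' ∈ closure I⁻(C)`.** Closure-free sufficient forms: recurrence in `I⁻(C)`, in `J⁻(C)`, or — for
  open `C`, e.g. `C = fd.charted` — in `closure C` itself (`farRaysShadowedBy_of_raysRecur_closure`).
* §3 the consequence for stub S per development: recurrence of the far rays in `closure I⁻(C)` (resp.
  in `closure fd.charted`) gives `endVisibleRegion 𝒟 ∩ J⁺(ι X) ⊆ exteriorOf 𝒟 C`
  (`endVisibleShadow_of_raysRecur`, `endVisibleShadow_charted_of_raysRecur_closure`).

So the chart-side half S of CENSOR for a given `fd` is EXACTLY implied by the typed missing fact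
"far complete rays recur in the closure of the charted late region" (ray capture by honest charts),
with no loss: the uniform-`K` shadowing form and the recurrence form coincide. Parallel to §4 of
`PhotonSphereChannelsEndVisibleOuterRegion` (which did this for clause (C) and for NoHidden); nothing
here restates a route item, and stub S itself stays open.

References: B. O'Neill, *Semi-Riemannian geometry* (1983), Ch. 14, Lemma 14.3 (p. 403: `I⁺(A)` open),
Lemma 14.6 (2), Cor. 14.1 (push-up); S. W. Hawking, G. F. R. Ellis (1973), §6.8 (past sets), §9.2;
M. Dafermos, J. Luk, arXiv:1710.01722, Conjecture 1.
-/

noncomputable section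

-- the problem namespace `Summit.FinalStateConjecture.FinalStateConjecture` repeats a segment by design
set_option linter.dupNamespace false

open Set Filter Topology TopologicalSpace
open scoped Manifold ContDiff
open Literature.Geometry.Lorentzian
open Summit.FinalStateConjecture.FinalStateConjecture.Theorems

namespace Summit.FinalStateConjecture.FinalStateConjecture.Theorems.RenormalisedDrift.DriftCapture

/-! ## §1. Pointwise causal lemmas -/

section Pointwise

variable {X : Type} [TopologicalSpace X] [ChartedSpace E3 X] [IsManifold (𝓡 3) ∞ X]
  [ConnectedSpace X] {D : InitialDataSet (𝓡 3) X} {𝒟 : CauchyDevelopment D}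

/-- **`q ≪ q'` and `q' ∈ closure I⁻(C)` give `q ∈ I⁻(C)`**: `I⁺(q)` is an open neighbourhood of `q'`
(O'Neill, Lemma 14.3), so it meets `I⁻(C)` at some `e`; then `q ≪ e ∈ I⁻(C)` and `I⁻(C)` is a past set.
[cite: ONeillSemiRiemannian1983, Ch. 14, Lemma 14.3 (p. 403)] -/
theorem mem_chronologicalPast_of_chronologicalFuture_of_mem_closure {C : Set 𝒟.carrier}
    {q q' : 𝒟.carrier} (hqq' : q' ∈ 𝒟.metric.chronologicalFuture 𝒟.timeOrientation {q})
    (hq' : q' ∈ closure (𝒟.metric.chronologicalPast 𝒟.timeOrientation C)) :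
    q ∈ 𝒟.metric.chronologicalPast 𝒟.timeOrientation C := by
  obtain ⟨e, hqe, he⟩ := mem_closure_iff_nhds.1 hq' _
    ((LorentzianMetric.isOpen_chronologicalFuture_of_boundaryless 𝒟.metric 𝒟.timeOrientation {q}).mem_nhds
      hqq')
  exact LorentzianMetric.isPastSet_chronologicalPast (g := 𝒟.metric) (τ := 𝒟.timeOrientation) C
    (LorentzianMetric.chronologicalPast_mono (singleton_subset_iff.2 he)
      (LorentzianMetric.mem_chronologicalPast_of_mem_chronologicalFuture hqe))

/-- **An open set lies in its own chronological past**: for `C` open and `c ∈ C`, `c ∈ closure I⁺(c)`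
(O'Neill, Lemma 14.6 (2)), so the neighbourhood `C` of `c` contains some `e ≫ c`, whence `c ∈ I⁻(C)`.
[cite: ONeillSemiRiemannian1983, Ch. 14, Lemma 14.6 (2)] -/
theorem subset_chronologicalPast_of_isOpen {C : Set 𝒟.carrier} (hC : IsOpen C) :
    C ⊆ 𝒟.metric.chronologicalPast 𝒟.timeOrientation C := by
  intro c hc
  have hcl : c ∈ closure (𝒟.metric.chronologicalFuture 𝒟.timeOrientation {c}) :=
    𝒟.metric.subset_closure_chronologicalFuture 𝒟.timeOrientation {c} rfl
  obtain ⟨e, heC, hce⟩ := mem_closure_iff_nhds.1 hcl C (hC.mem_nhds hc)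
  exact LorentzianMetric.chronologicalPast_mono (singleton_subset_iff.2 heC)
    (LorentzianMetric.mem_chronologicalPast_of_mem_chronologicalFuture hce)

/-- For an open set `C`, `closure C ⊆ closure I⁻(C)`. [cite: ONeillSemiRiemannian1983, Ch. 14, Lemma 14.6 (2)] -/
theorem closure_subset_closure_chronologicalPast_of_isOpen {C : Set 𝒟.carrier} (hC : IsOpen C) :
    closure C ⊆ closure (𝒟.metric.chronologicalPast 𝒟.timeOrientation C) :=
  closure_mono (subset_chronologicalPast_of_isOpen hC)

/-- The causal past lies in the closure of the chronological past, `J⁻(C) ⊆ closure I⁻(C)` (O'Neill,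
Lemma 14.6, time dual). [cite: ONeillSemiRiemannian1983, Ch. 14, Lemma 14.6 (2)] -/
theorem causalPast_subset_closure_chronologicalPast (C : Set 𝒟.carrier) :
    𝒟.metric.causalPast 𝒟.timeOrientation C ⊆ closure (𝒟.metric.chronologicalPast 𝒟.timeOrientation C) :=
  LorentzianMetric.causalFuture_subset_closure_chronologicalFuture_of_boundaryless
    (τ := 𝒟.timeOrientation.reverse) (WithTop.coe_le_coe.mpr le_top) C

end Pointwise

/-- **The charted late region of a final state decomposition is open**: each of the `N + 1` late
charts is an open embedding of its (open) late region (`IsLateChart.isOpenEmbedding`), so its image is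
open. [cite: arXiv210408222, §1] -/
theorem isOpen_charted {𝓢 : Spacetime.{0} 4} {O : Set 𝓢.carrier} {k : ℕ} (d : FinalStateDecomposition 𝓢 O k) :
    IsOpen d.charted := by
  -- adapted from `Cruxes/SeamedChartsExhaust/IdeaOneCurveDichotomySketch.lean` (`isOpen_charted`, k = 2)
  refine IsOpen.union ?_ (isOpen_iUnion fun i ↦ ?_)
  · have h := d.isLateChart_flat.isOpenEmbedding.isOpen_range
    rwa [Set.range_restrict] at h
  · have h := (d.isLateChart i).isOpenEmbedding.isOpen_range
    rwa [Set.range_restrict] at h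

/-! ## §2. Shadowing ⇔ the far complete rays stay in / recur to `closure I⁻(C)` -/

section Shadowing

variable {X : Type} [TopologicalSpace X] [ChartedSpace E3 X] [IsManifold (𝓡 3) ∞ X]
  [ConnectedSpace X] {D : InitialDataSet (𝓡 3) X} {𝒟 : CauchyDevelopment D}

/-- **RAYS NEAR `I⁻(C)` ⇒ SHADOWING.** If outside the compact `K ⊆ X` every point `δ t`, `t ≥ 0`, of
every future-complete normalised null ray `δ` from `p ∉ K` lies in `closure I⁻(C)`, then the far rays
are shadowed by `C`: for `q ∈ I⁻(δ(s ∩ [0, ∞)))`, i.e. `q ≪ δ t`, the open `I⁺(q) ∋ δ t` meets `I⁻(C)`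
(§1). [cite: ONeillSemiRiemannian1983, Ch. 14, Lemma 14.3 (p. 403)] -/
theorem farRaysShadowedBy_of_forall_mem_closure [𝒟.metric.HasLeviCivita] {C : Set 𝒟.carrier}
    {K : Set X} (hK : IsCompact K)
    (h : ∀ p ∉ K, ∀ (δ : ℝ → 𝒟.carrier) (s : Set ℝ),
      𝒟.metric.IsNormalisedNullRayFrom 𝒟.timeOrientation 𝒟.embed 𝒟.normal p δ s → ¬ BddAbove s →
        ∀ t ∈ s, 0 ≤ t → δ t ∈ closure (𝒟.metric.chronologicalPast 𝒟.timeOrientation C)) :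
    EndVisible.FarRaysShadowedBy 𝒟 C := by
  refine ⟨K, hK, fun p hp δ s hδ hs q hq ↦ ?_⟩
  obtain ⟨x, ⟨t, ⟨ht, ht0⟩, rfl⟩, hqx⟩ :=
    (LorentzianMetric.mem_chronologicalPast_iff_exists (g := 𝒟.metric) (τ := 𝒟.timeOrientation)).1 hq
  exact mem_chronologicalPast_of_chronologicalFuture_of_mem_closure hqx (h p hp δ s hδ hs t ht ht0)

/-- **SHADOWING ⇒ RAYS NEAR `I⁻(C)`** (converse): if the far rays are shadowed by `C` (with exempted
compact `K`), then every point `δ t`, `t ≥ 0`, of every future-complete normalised null ray from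
`p ∉ K` lies in `closure I⁻(C)` — since `δ t ∈ closure I⁻(δ t)` (O'Neill, Lemma 14.6 (2), time dual) and
`I⁻(δ t) ⊆ I⁻(δ(s ∩ [0, ∞))) ⊆ I⁻(C)`. [cite: ONeillSemiRiemannian1983, Ch. 14, Lemma 14.6 (2)] -/
theorem forall_mem_closure_of_farRaysShadowedBy [𝒟.metric.HasLeviCivita] {C : Set 𝒟.carrier}
    (h : EndVisible.FarRaysShadowedBy 𝒟 C) :
    ∃ K : Set X, IsCompact K ∧ ∀ p ∉ K, ∀ (δ : ℝ → 𝒟.carrier) (s : Set ℝ),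
      𝒟.metric.IsNormalisedNullRayFrom 𝒟.timeOrientation 𝒟.embed 𝒟.normal p δ s → ¬ BddAbove s →
        ∀ t ∈ s, 0 ≤ t → δ t ∈ closure (𝒟.metric.chronologicalPast 𝒟.timeOrientation C) := by
  obtain ⟨K, hK, hfar⟩ := h
  refine ⟨K, hK, fun p hp δ s hδ hs t ht ht0 ↦ ?_⟩
  have hmem : δ t ∈ δ '' (s ∩ Ici 0) := mem_image_of_mem δ ⟨ht, ht0⟩
  have hcl : δ t ∈ closure (𝒟.metric.chronologicalPast 𝒟.timeOrientation (δ '' (s ∩ Ici 0))) :=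
    closure_mono (LorentzianMetric.chronologicalPast_mono (singleton_subset_iff.2 hmem))
      (𝒟.metric.subset_closure_chronologicalFuture 𝒟.timeOrientation.reverse {δ t} rfl)
  exact closure_mono (hfar p hp δ s hδ hs) hcl

/-- **SHADOWING IS A STATEMENT ABOUT RAY POINTS**: `FarRaysShadowedBy 𝒟 C` iff outside some compact
`K ⊆ X` every point `δ t`, `t ≥ 0`, of every future-complete normalised null ray from `p ∉ K` lies in
`closure I⁻(C)`. [cite: ONeillSemiRiemannian1983, Ch. 14, Lemma 14.6 (2)] -/
theorem farRaysShadowedBy_iff_forall_mem_closure [𝒟.metric.HasLeviCivita] {C : Set 𝒟.carrier} :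
    EndVisible.FarRaysShadowedBy 𝒟 C ↔
      ∃ K : Set X, IsCompact K ∧ ∀ p ∉ K, ∀ (δ : ℝ → 𝒟.carrier) (s : Set ℝ),
        𝒟.metric.IsNormalisedNullRayFrom 𝒟.timeOrientation 𝒟.embed 𝒟.normal p δ s → ¬ BddAbove s →
          ∀ t ∈ s, 0 ≤ t → δ t ∈ closure (𝒟.metric.chronologicalPast 𝒟.timeOrientation C) :=
  ⟨forall_mem_closure_of_farRaysShadowedBy, fun ⟨_, hK, h⟩ ↦ farRaysShadowedBy_of_forall_mem_closure hK h⟩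

/-- **RAY RECURRENCE ⇒ SHADOWING.** If outside the compact `K ⊆ X` every future-complete normalised
null ray `δ` (affine domain `s`, unbounded above) from `p ∉ K` RECURS to `closure I⁻(C)` — for every
`t ∈ s`, `t ≥ 0`, there is `t' ∈ s`, `t ≤ t'`, with `δ t' ∈ closure I⁻(C)` — then the far rays are
shadowed by `C`. Along the ray `δ t ≤ δ t'` (`EndVisible.mem_causalFuture_of_le`), and membership in
the closure of the past set `I⁻(C)` passes down causal curves (push-up,
`EndVisible.mem_closure_of_mem_causalFuture_of_isPastSet`), so every `δ t`, `t ≥ 0`, lies in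
`closure I⁻(C)`. This is the formal half of the chart side of CENSOR: the remaining content of stub S
for a decomposition `fd` is that far complete rays recur in `closure I⁻(fd.charted)`.
[cite: ONeillSemiRiemannian1983, Ch. 14, Cor. 14.1 (p. 402)] -/
theorem farRaysShadowedBy_of_raysRecur [𝒟.metric.HasLeviCivita] {C : Set 𝒟.carrier} {K : Set X}
    (hK : IsCompact K)
    (h : ∀ p ∉ K, ∀ (δ : ℝ → 𝒟.carrier) (s : Set ℝ),
      𝒟.metric.IsNormalisedNullRayFrom 𝒟.timeOrientation 𝒟.embed 𝒟.normal p δ s → ¬ BddAbove s →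
        ∀ t ∈ s, 0 ≤ t → ∃ t' ∈ s, t ≤ t' ∧
          δ t' ∈ closure (𝒟.metric.chronologicalPast 𝒟.timeOrientation C)) :
    EndVisible.FarRaysShadowedBy 𝒟 C := by
  refine farRaysShadowedBy_of_forall_mem_closure hK fun p hp δ s hδ hs t ht ht0 ↦ ?_
  obtain ⟨t', ht', htt', hcl⟩ := h p hp δ s hδ hs t ht ht0
  exact EndVisible.mem_closure_of_le_of_isPastSet
    (LorentzianMetric.isPastSet_chronologicalPast (g := 𝒟.metric) (τ := 𝒟.timeOrientation) C)
    hδ ht ht' htt' hcl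

/-- **SHADOWING ⇔ RAY RECURRENCE**: `FarRaysShadowedBy 𝒟 C` iff outside some compact `K ⊆ X` every
future-complete normalised null ray from `p ∉ K` returns to `closure I⁻(C)` at arbitrarily late
parameters (after every `t ≥ 0` of its domain). So a counterexample to shadowing is exactly a family of
complete rays launched from arbitrarily far out on `Σ` each of which is EVENTUALLY OUTSIDE
`closure I⁻(C)` for good. [cite: HawkingEllis1973, §6.8] -/
theorem farRaysShadowedBy_iff_raysRecur [𝒟.metric.HasLeviCivita] {C : Set 𝒟.carrier} :
    EndVisible.FarRaysShadowedBy 𝒟 C ↔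
      ∃ K : Set X, IsCompact K ∧ ∀ p ∉ K, ∀ (δ : ℝ → 𝒟.carrier) (s : Set ℝ),
        𝒟.metric.IsNormalisedNullRayFrom 𝒟.timeOrientation 𝒟.embed 𝒟.normal p δ s → ¬ BddAbove s →
          ∀ t ∈ s, 0 ≤ t → ∃ t' ∈ s, t ≤ t' ∧
            δ t' ∈ closure (𝒟.metric.chronologicalPast 𝒟.timeOrientation C) := by
  constructor
  · intro h
    obtain ⟨K, hK, h⟩ := forall_mem_closure_of_farRaysShadowedBy h
    exact ⟨K, hK, fun p hp δ s hδ hs t ht ht0 ↦ ⟨t, ht, le_rfl, h p hp δ s hδ hs t ht ht0⟩⟩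
  · rintro ⟨K, hK, h⟩
    exact farRaysShadowedBy_of_raysRecur hK h

/-- **Recurrence in `I⁻(C)` itself suffices** (closure-free form: every far complete ray has, after
every `t ≥ 0`, a point from which a timelike signal reaches `C`). [cite: ONeillSemiRiemannian1983, Ch. 14, Cor. 14.1 (p. 402)] -/
theorem farRaysShadowedBy_of_raysRecur_chronologicalPast [𝒟.metric.HasLeviCivita] {C : Set 𝒟.carrier}
    {K : Set X} (hK : IsCompact K)
    (h : ∀ p ∉ K, ∀ (δ : ℝ → 𝒟.carrier) (s : Set ℝ),
      𝒟.metric.IsNormalisedNullRayFrom 𝒟.timeOrientation 𝒟.embed 𝒟.normal p δ s → ¬ BddAbove s →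
        ∀ t ∈ s, 0 ≤ t → ∃ t' ∈ s, t ≤ t' ∧ δ t' ∈ 𝒟.metric.chronologicalPast 𝒟.timeOrientation C) :
    EndVisible.FarRaysShadowedBy 𝒟 C := by
  refine farRaysShadowedBy_of_raysRecur hK fun p hp δ s hδ hs t ht ht0 ↦ ?_
  obtain ⟨t', ht', htt', hmem⟩ := h p hp δ s hδ hs t ht ht0
  exact ⟨t', ht', htt', subset_closure hmem⟩

/-- **Recurrence in `J⁻(C)` suffices** (every far complete ray has, after every `t ≥ 0`, a point in
`C` or from which a causal signal reaches `C`; `J⁻(C) ⊆ closure I⁻(C)`).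
[cite: ONeillSemiRiemannian1983, Ch. 14, Lemma 14.6 (2)] -/
theorem farRaysShadowedBy_of_raysRecur_causalPast [𝒟.metric.HasLeviCivita] {C : Set 𝒟.carrier}
    {K : Set X} (hK : IsCompact K)
    (h : ∀ p ∉ K, ∀ (δ : ℝ → 𝒟.carrier) (s : Set ℝ),
      𝒟.metric.IsNormalisedNullRayFrom 𝒟.timeOrientation 𝒟.embed 𝒟.normal p δ s → ¬ BddAbove s →
        ∀ t ∈ s, 0 ≤ t → ∃ t' ∈ s, t ≤ t' ∧ δ t' ∈ 𝒟.metric.causalPast 𝒟.timeOrientation C) :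
    EndVisible.FarRaysShadowedBy 𝒟 C := by
  refine farRaysShadowedBy_of_raysRecur hK fun p hp δ s hδ hs t ht ht0 ↦ ?_
  obtain ⟨t', ht', htt', hmem⟩ := h p hp δ s hδ hs t ht ht0
  exact ⟨t', ht', htt', causalPast_subset_closure_chronologicalPast C hmem⟩

/-- **Recurrence in `closure C` suffices when `C` is open** (the natural form for the charted late
region: every far complete ray returns, at arbitrarily late parameters, to the closure of the radiation
zone or of a near zone). [cite: ONeillSemiRiemannian1983, Ch. 14, Lemma 14.6 (2)] -/
theorem farRaysShadowedBy_of_raysRecur_closure [𝒟.metric.HasLeviCivita] {C : Set 𝒟.carrier}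
    (hC : IsOpen C) {K : Set X} (hK : IsCompact K)
    (h : ∀ p ∉ K, ∀ (δ : ℝ → 𝒟.carrier) (s : Set ℝ),
      𝒟.metric.IsNormalisedNullRayFrom 𝒟.timeOrientation 𝒟.embed 𝒟.normal p δ s → ¬ BddAbove s →
        ∀ t ∈ s, 0 ≤ t → ∃ t' ∈ s, t ≤ t' ∧ δ t' ∈ closure C) :
    EndVisible.FarRaysShadowedBy 𝒟 C := by
  refine farRaysShadowedBy_of_raysRecur hK fun p hp δ s hδ hs t ht ht0 ↦ ?_
  obtain ⟨t', ht', htt', hmem⟩ := h p hp δ s hδ hs t ht ht0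
  exact ⟨t', ht', htt', closure_subset_closure_chronologicalPast_of_isOpen hC hmem⟩

/-! ## §3. The consequence for stub S, per development -/

/-- **CENSOR-S at `(𝒟, C)` from ray recurrence**: if outside a compact `K ⊆ X` every future-complete
normalised null ray from `p ∉ K` recurs to `closure I⁻(C)`, then
`endVisibleRegion 𝒟 ∩ J⁺(ι X) ⊆ exteriorOf 𝒟 C` (shadowing, then the landed
`EndVisible.endVisibleRegion_inter_causalFuture_subset_exteriorOf`). [cite: DafermosLuk2017, Conjecture 1] -/
theorem endVisibleShadow_of_raysRecur [𝒟.metric.HasLeviCivita] {C : Set 𝒟.carrier} {K : Set X}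
    (hK : IsCompact K)
    (h : ∀ p ∉ K, ∀ (δ : ℝ → 𝒟.carrier) (s : Set ℝ),
      𝒟.metric.IsNormalisedNullRayFrom 𝒟.timeOrientation 𝒟.embed 𝒟.normal p δ s → ¬ BddAbove s →
        ∀ t ∈ s, 0 ≤ t → ∃ t' ∈ s, t ≤ t' ∧
          δ t' ∈ closure (𝒟.metric.chronologicalPast 𝒟.timeOrientation C)) :
    EndVisible.endVisibleRegion 𝒟 ∩ 𝒟.metric.causalFuture 𝒟.timeOrientation (range 𝒟.embed) ⊆
      _root_.Summit.FinalStateConjecture.exteriorOf 𝒟 C :=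
  EndVisible.endVisibleRegion_inter_causalFuture_subset_exteriorOf (farRaysShadowedBy_of_raysRecur hK h)

/-- **CENSOR-S for a decomposition from ray capture by its charts**: if outside a compact `K ⊆ X`
every future-complete normalised null ray of the vacuum Cauchy development `𝒟` from `p ∉ K` returns to
`closure fd.charted` at arbitrarily late parameters, then
`endVisibleRegion 𝒟 ∩ J⁺(ι X) ⊆ exteriorOf 𝒟 fd.charted` — the conclusion of stub S at `(𝒟, fd)`
(`fd.charted` is open, `isOpen_charted`). [cite: DafermosLuk2017, Conjecture 1] -/
theorem endVisibleShadow_charted_of_raysRecur_closure {𝒟 : VacuumCauchyDevelopment D}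
    [𝒟.metric.HasLeviCivita] {O : Set 𝒟.carrier} {k : ℕ} (fd : FinalStateDecomposition 𝒟.toSpacetime O k)
    {K : Set X} (hK : IsCompact K)
    (h : ∀ p ∉ K, ∀ (δ : ℝ → 𝒟.carrier) (s : Set ℝ),
      𝒟.metric.IsNormalisedNullRayFrom 𝒟.timeOrientation 𝒟.embed 𝒟.normal p δ s → ¬ BddAbove s →
        ∀ t ∈ s, 0 ≤ t → ∃ t' ∈ s, t ≤ t' ∧ δ t' ∈ closure fd.charted) :
    EndVisible.endVisibleRegion 𝒟.toCauchyDevelopment ∩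
        𝒟.metric.causalFuture 𝒟.timeOrientation (range 𝒟.embed) ⊆
      _root_.Summit.FinalStateConjecture.exteriorOf 𝒟.toCauchyDevelopment fd.charted :=
  EndVisible.endVisibleRegion_inter_causalFuture_subset_exteriorOf
    (farRaysShadowedBy_of_raysRecur_closure (𝒟 := 𝒟.toCauchyDevelopment) (isOpen_charted fd) hK h)

end Shadowing

/-- **Registered sub-goal `censorS_of_raysRecurCharted` of stmt-FinalStateConjecture-17391** (header on one
line = the registered signature; = `endVisibleShadow_charted_of_raysRecur_closure`): the conclusion of stub
CENSOR-S at `(𝒟, fd)` from capture of the far complete rays by `closure fd.charted`.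
[cite: DafermosLuk2017, Conjecture 1] -/
theorem censorS_of_raysRecurCharted : open Literature.Geometry.Lorentzian Summit.FinalStateConjecture.FinalStateConjecture.Theorems in open scoped Manifold ContDiff in ∀ {X : Type} [TopologicalSpace X] [ChartedSpace E3 X] [IsManifold (𝓡 3) ∞ X] [ConnectedSpace X] {D : InitialDataSet (𝓡 3) X} {𝒟 : VacuumCauchyDevelopment D} [𝒟.metric.HasLeviCivita] {O : Set 𝒟.carrier} {k : ℕ} (fd : FinalStateDecomposition 𝒟.toSpacetime O k) {K : Set X}, IsCompact K → (∀ p ∉ K, ∀ (δ : ℝ → 𝒟.carrier) (s : Set ℝ), 𝒟.metric.IsNormalisedNullRayFrom 𝒟.timeOrientation 𝒟.embed 𝒟.normal p δ s → ¬ BddAbove s → ∀ t ∈ s, 0 ≤ t → ∃ t' ∈ s, t ≤ t' ∧ δ t' ∈ closure fd.charted) → EndVisible.endVisibleRegion 𝒟.toCauchyDevelopment ∩ 𝒟.metric.causalFuture 𝒟.timeOrientation (Set.range 𝒟.embed) ⊆ _root_.Summit.FinalStateConjecture.exteriorOf 𝒟.toCauchyDevelopment fd.charted :=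
  fun fd _ hK h ↦ endVisibleShadow_charted_of_raysRecur_closure fd hK h

end Summit.FinalStateConjecture.FinalStateConjecture.Theorems.RenormalisedDrift.DriftCapture

end
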